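import Literature.MathematicalPhysics.QuantumFieldTheory.Balaban1983to89.T3LowerActionSplit
import Literature.MathematicalPhysics.QuantumFieldTheory.Balaban1983to89.T3Thresholds
import HarnessLib

/-!
# `Balaban1983to89.T3CurvGradLog` — rung R3, crux K1, child «MinimiserStabilityRegPr» (stmt-QuantumFields-19200): the LOG-LIPSCHITZ form of
# [Balaban1985Variational] Thm 1 (9) at the T³ carrier (`MinimiserCurvGradLogAt`, `CritCurvGradLogAt`: the curvature-gradient bound `B₄ε₁` of the
# `β₀ = 1` reading weakened to `B₄ε₁·((K − n) + 1)`, i.e. (9) for every `β < 1` with a rate `B₄(β) = O((1 − β)⁻¹)`), the K-linear threshold lemma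
# `exists_gamma_forall_Kmul_θBal_le`, and the LOWER divergence clause of the averaged minimiser re-derived from the weakened schema
# (`divSmall_descendTo_log`)

Cell `ym3-torus` (HUMAN RULING D-0037, YM ladder rung R3), seat `ym3-torus-p1` gen 12 (UV side); cell record HOME/UV3-NODE.md §21 (finding F-g12-1).
WHY.  The line's schema `T3AvgDivergenceSplit.MinimiserCurvGradAt` reads (9) at `β = β₀ = 1`; print derives (9) only through [Balaban1985RegularSpaces]
Thm 2 (1.36) (`β ≤ β₀ < 1`, constant degenerating at the endpoint; p. 83: «Such information is unavailable for the second order derivatives»), and the cell's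
finding F-g12-1 (HOME/UV3-NODE.md §21, evidence on the item) is that the `β₀ = 1` reading fails like `(K − n)·log L` for the constrained minimiser while
every window of the line tolerates a polynomial factor in `K − n` (`ε₁ = B₃·θBal(⌊K/m⌋)` decays geometrically).  Hypothesis schemas, never asserted;
the compositions are kernel-checked.

* §1 schemas `MinimiserCurvGradLogAt`, `CritCurvGradLogAt` (+ monotonicity, `…_of_minimiserCurvGradAt`, `…_of_crit`); §2 the K-linear threshold
  `exists_gamma_forall_Kmul_θBal_le`; §3 `divSmall_descendTo_log`, `descendTo_mem_regFibrePr_log` (the LOWER/UPPER compositions are in `T3SplitLog`).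

References: T. Bałaban, CMP 102 (1985) 277–309 [Balaban1985Variational] (Thm 1 (9)–(10) p.279, Prop 8 p.304); CMP 99 (1985) 75–102
[Balaban1985RegularSpaces] ((1.1)–(1.2) p.76, Thm 2 (1.36)–(1.39) pp.82–83); CMP 102 (1985) 255–275 [Balaban1985UV3] ((3) p.256, (7) p.257).
-/

noncomputable section

open MeasureTheory Filter Topology
open scoped Matrix.Norms.L2Operator
open Literature.MathematicalPhysics.QuantumFieldTheory.Balaban1983to89.T3ContinuumYM3Torus
open Literature.MathematicalPhysics.QuantumFieldTheory.Balaban1983to89.T3UnitLawDensityEML (ℰp measurableE_ℰp)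
open Literature.MathematicalPhysics.QuantumFieldTheory.Balaban1983to89.T3UnitScaleTilt
open Literature.MathematicalPhysics.QuantumFieldTheory.Balaban1983to89.T3TiltDescent
open Literature.MathematicalPhysics.QuantumFieldTheory.Balaban1983to89.T3CruxEstimates
open Literature.MathematicalPhysics.QuantumFieldTheory.Balaban1983to89.T3ConstrainedMinimiser
open Literature.MathematicalPhysics.QuantumFieldTheory.Balaban1983to89.T3DescentFibreTower
open Literature.MathematicalPhysics.QuantumFieldTheory.Balaban1983to89.T3MinimiserStabilityReduction
open Literature.MathematicalPhysics.QuantumFieldTheory.Balaban1983to89.T3RegularMinimiser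
open Literature.MathematicalPhysics.QuantumFieldTheory.Balaban1983to89.T3PrintedRegularMinimiser
open Literature.MathematicalPhysics.QuantumFieldTheory.Balaban1983to89.T3PrintedRegularMinimiserReduction
open Literature.MathematicalPhysics.QuantumFieldTheory.Balaban1983to89.T3PrintedMinimiserExistence
open Literature.MathematicalPhysics.QuantumFieldTheory.Balaban1983to89.T3Thresholds
open Literature.MathematicalPhysics.QuantumFieldTheory.Balaban1983to89.T3LowerAlongMinimisersSplit
open Literature.MathematicalPhysics.QuantumFieldTheory.Balaban1983to89.T3OneStepAveragingPlaquettes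
open Literature.MathematicalPhysics.QuantumFieldTheory.Balaban1983to89.T3AvgDivergenceSplit
open Literature.MathematicalPhysics.QuantumFieldTheory.Balaban1983to89.T3UpperLiftSplit
open Literature.MathematicalPhysics.QuantumFieldTheory.Balaban1983to89.B10Eq27TorusAxialLog (toUField unitsField)
open Literature.MathematicalPhysics.QuantumFieldTheory.Balaban1983to89.B10Eq68TorusRegularity (plaqFT covDerivT covDivT)
open Literature.MathematicalPhysics.QuantumFieldTheory.Balaban1983to89.ExpMeanLog (deltaSU deltaSU_pos)
open Literature.MathematicalPhysics.QuantumFieldTheory.Balaban1983to89.Missing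

namespace Literature.MathematicalPhysics.QuantumFieldTheory.Balaban1983to89.T3CurvGradLog

/-! ## §1 The weakened (log-Lipschitz) curvature-gradient schemas -/

section Schemas

/-- **[Balaban1985Variational] THM 1 (9) FOR `β < 1` WITH RATE, READ AT THE TOP SCALE, FOR MINIMISERS OVER (6)** (hypothesis schema, never
asserted): as `T3AvgDivergenceSplit.MinimiserCurvGradAt` but with the bound `B₄ε₁·((K − n) + 1)·L^{−3(K−n)}` — one factor `(K − n) + 1 ≍ log(1/η)/log L`
more than the `β₀ = 1` reading; equivalently (9) for every `0 ≤ β < 1` with `B₄(β) ≤ B₄/(1 − β)` optimised in `β` at lattice resolution.  Print states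
(9) «for 0 ≤ β ≤ β₀ = 1» (p. 279) but derives it from [Balaban1985RegularSpaces] Thm 2 (1.36), stated for `β ≤ β₀ < 1` with `B₂(β₀)` «depending on β₀
also» (the rate is not printed — located bookkeeping). [cite: Balaban1985Variational, Thm 1 (9) p.279; Balaban1985RegularSpaces, Thm 2 (1.36) p.82] -/
def MinimiserCurvGradLogAt (L : ℕ) (a₀ a₁ B₃ B₄ : ℝ) : Prop :=
  ∀ F : T3Family, F.L = L → ∀ (n K : ℕ) (hnK : n < K) (ε₁ ε₀ : ℝ), 0 < ε₁ → ε₁ ≤ a₁ → B₃ * ε₁ ≤ ε₀ → ε₀ ≤ a₀ →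
    ∀ V : GaugeField (F.P n) 0 (Matrix.specialUnitaryGroup (Fin 2) ℂ), PlaqSmall ε₁ V →
      ∀ U ∈ regFibrePr F n K hnK.le ε₀ V,
        IsMinOn (fun W : GaugeField (F.P K) 0 (Matrix.specialUnitaryGroup (Fin 2) ℂ) => wilsonAction4 W) (regFibrePr F n K hnK.le ε₀ V) U →
          ∀ (x : Site (F.P K) 0) (ν κ κ' : Fin (F.P K).d), κ ≠ κ' →
            ‖covDerivT 1 (unitsField (toUField U)) ν (plaqFT (unitsField (toUField U)) κ κ') x‖ <
              B₄ * ε₁ * (((K - n : ℕ) : ℝ) + 1) * ((F.L : ℝ)⁻¹) ^ (3 * (K - n))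

/-- **THE SAME FOR CRITICAL CONFIGURATIONS IN (8)** (reading R2 of `T3Thm1Carrier`: minimises (5) over print's regular fibre (6)(e) for SOME `e > 0`)
— the log-Lipschitz twin of `T3Thm1CarrierNative.CritCurvGradAt` (the one clause of V4 `stub_sectF` at the carrier).
[cite: Balaban1985Variational, Thm 1 (9) p.279 and Sect. F (169) p.305] -/
def CritCurvGradLogAt (L : ℕ) (a₁ B₃ B₄ : ℝ) : Prop :=
  ∀ F : T3Family, F.L = L → ∀ (n K : ℕ) (hnK : n < K) (ε₁ : ℝ), 0 < ε₁ → ε₁ ≤ a₁ →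
    ∀ V : GaugeField (F.P n) 0 (Matrix.specialUnitaryGroup (Fin 2) ℂ), PlaqSmall ε₁ V →
      ∀ U : GaugeField (F.P K) 0 (Matrix.specialUnitaryGroup (Fin 2) ℂ), RegPr F n K (B₃ * ε₁) U → U ∈ fibre F ℰp n K hnK.le V →
        (∃ e : ℝ, 0 < e ∧ U ∈ regFibrePr F n K hnK.le e V ∧
          IsMinOn (fun W : GaugeField (F.P K) 0 (Matrix.specialUnitaryGroup (Fin 2) ℂ) => wilsonAction4 W) (regFibrePr F n K hnK.le e V) U) →
          ∀ (x : Site (F.P K) 0) (ν κ κ' : Fin (F.P K).d), κ ≠ κ' →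
            ‖covDerivT 1 (unitsField (toUField U)) ν (plaqFT (unitsField (toUField U)) κ κ') x‖ <
              B₄ * ε₁ * (((K - n : ℕ) : ℝ) + 1) * ((F.L : ℝ)⁻¹) ^ (3 * (K - n))

/-- **THE `β₀ = 1` SCHEMA IMPLIES THE WEAKENED ONE** (`(K − n) + 1 ≥ 1`): every composition below is fed by strictly less than the line's v5 input.
[cite: Balaban1985Variational, Thm 1 (9) p.279] -/
theorem minimiserCurvGradLogAt_of_minimiserCurvGradAt {L : ℕ} {a₀ a₁ B₃ B₄ : ℝ} (hB₄ : 0 ≤ B₄) (h : MinimiserCurvGradAt L a₀ a₁ B₃ B₄) :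
    MinimiserCurvGradLogAt L a₀ a₁ B₃ B₄ := by
  intro F hF n K hnK ε₁ ε₀ hε₁ hε₁a hlo hhi V hV U hU hmin x ν κ κ' hne
  refine (h F hF n K hnK ε₁ ε₀ hε₁ hε₁a hlo hhi V hV U hU hmin x ν κ κ' hne).trans_le ?_
  have hη : (0 : ℝ) ≤ ((F.L : ℝ)⁻¹) ^ (3 * (K - n)) := pow_nonneg (inv_nonneg.mpr (Nat.cast_nonneg _)) _
  have hk : (1 : ℝ) ≤ ((K - n : ℕ) : ℝ) + 1 := by have := Nat.cast_nonneg (α := ℝ) (K - n); linarith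
  have h1 : B₄ * ε₁ ≤ B₄ * ε₁ * (((K - n : ℕ) : ℝ) + 1) := le_mul_of_one_le_right (mul_nonneg hB₄ hε₁.le) hk
  exact mul_le_mul_of_nonneg_right h1 hη

/-- `MinimiserCurvGradLogAt` is monotone in `B₃` (only the window shrinks) and antitone in `a₁`. [cite: Balaban1985Variational, Thm 1 (9) p.279] -/
theorem minimiserCurvGradLogAt_mono {L : ℕ} {a₀ a₁ a₁' B₃ B₃' B₄ : ℝ} (ha : a₁' ≤ a₁) (hB : B₃ ≤ B₃')
    (hg : MinimiserCurvGradLogAt L a₀ a₁ B₃ B₄) : MinimiserCurvGradLogAt L a₀ a₁' B₃' B₄ :=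
  fun F hF n K hnK ε₁ ε₀ hε₁ hε₁a hlo hhi V hV U hU hmin =>
    hg F hF n K hnK ε₁ ε₀ hε₁ (hε₁a.trans ha) ((mul_le_mul_of_nonneg_right hB hε₁.le).trans hlo) hhi V hV U hU hmin

/-- `CritCurvGradLogAt` is antitone in `a₁`. [cite: Balaban1985Variational, Thm 1 (9) p.279] -/
theorem critCurvGradLogAt_anti {L : ℕ} {a₁ a₁' B₃ B₄ : ℝ} (ha : a₁' ≤ a₁) (h : CritCurvGradLogAt L a₁ B₃ B₄) :
    CritCurvGradLogAt L a₁' B₃ B₄ :=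
  fun F hF n K hnK ε₁ hε₁ hε₁a V hV U hU8 hUB hcrit => h F hF n K hnK ε₁ hε₁ (hε₁a.trans ha) V hV U hU8 hUB hcrit

/-- **CRITICAL-FORM ∧ PROP 8's CONCLUSION ⇒ MINIMISER-FORM**: a minimiser over (6)(ε₀) (`0 < B₃ε₁ ≤ ε₀`) is critical in reading R2 (`e = ε₀`) and lies
in (8) by `MinimisersIn8At`. [cite: Balaban1985Variational, Thm 1 (9) p.279 and Prop 8 p.304] -/
theorem minimiserCurvGradLogAt_of_crit {L : ℕ} {a₀ a₁ B₃ B₄ : ℝ} (hB₃ : 0 < B₃) (h : CritCurvGradLogAt L a₁ B₃ B₄)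
    (h8 : MinimisersIn8At L a₀ a₁ B₃) : MinimiserCurvGradLogAt L a₀ a₁ B₃ B₄ := by
  intro F hF n K hnK ε₁ ε₀ hε₁ hε₁a hlo hhi V hV U hU hmin x ν κ κ' hne
  have hε₀ : 0 < ε₀ := (mul_pos hB₃ hε₁).trans_le hlo
  have hU8 : U ∈ regFibrePr F n K hnK.le (B₃ * ε₁) V := h8 F hF n K hnK ε₁ ε₀ hε₁ hε₁a hlo hhi V hV U hU hmin
  exact h F hF n K hnK ε₁ hε₁ hε₁a V hV U ((mem_regFibrePr_iff F).mp hU8).2 hU8.1.1 ⟨ε₀, hε₀, hU, hmin⟩ x ν κ κ' hne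

end Schemas

/-! ## §2 The K-linear threshold lemma: `(K + 2)·θBal(⌊K/m⌋)` is uniformly small for small `γ` -/

section Thresholds

/-- `√(x^i) = (√x)^i` for `x ≥ 0` (bookkeeping). [folklore] -/
private theorem sqrt_pow_eq {x : ℝ} (hx : 0 ≤ x) (i : ℕ) : Real.sqrt (x ^ i) = Real.sqrt x ^ i := by
  rw [← Real.sqrt_sq (pow_nonneg (Real.sqrt_nonneg x) i), ← pow_mul, mul_comm, pow_mul, Real.sq_sqrt hx]

/-- `n·qⁿ ≤ q/(1 − q)²` for `0 ≤ q < 1` (one term of `Σ n qⁿ = q/(1−q)²`). [folklore] -/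
private theorem nat_mul_pow_le {q : ℝ} (hq : 0 ≤ q) (hq1 : q < 1) (n : ℕ) : (n : ℝ) * q ^ n ≤ q / (1 - q) ^ 2 := by
  have hnorm : ‖q‖ < 1 := by rw [Real.norm_of_nonneg hq]; exact hq1
  have hs : Summable (fun k : ℕ => (k : ℝ) * q ^ k) := by
    simpa using summable_pow_mul_geometric_of_norm_lt_one 1 hnorm
  rw [← tsum_coe_mul_geometric_of_norm_lt_one hnorm]
  exact hs.le_tsum n (fun j _ => mul_nonneg (Nat.cast_nonneg _) (pow_nonneg hq _))

/-- **THE K-LINEAR THRESHOLD**: for `L > 1`, `b₀, p₀ > 0`, `m > 0` and every `σ > 0` there is `γ₁ ∈ (0, 1]` such that `(K + 2)·θBal L γ b₀ p₀ ⌊K/m⌋ ≤ σ`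
for ALL `0 < γ ≤ γ₁` and ALL `K` — the thresholds decay geometrically in the height (`θ(i) ≤ b₀(2p₀)^{p₀}e^{½−p₀}·(γL^{−i})^{1/4}`,
`T3Thresholds.θBal_le_const_mul_sqrt_coupling`), so a prefactor linear in `K ≤ m(⌊K/m⌋ + 1)` is absorbed and the bound is `O(γ^{1/4})`.  This is how every
window «const·((K − n) + 1)·ε₁ ≤ ε₀» of the log-weakened compositions is met at `ε₁ = θBal(⌊K/m⌋)`. [cite: Balaban1985UV3, (3) p.256 and (7) p.257] -/
theorem exists_gamma_forall_Kmul_θBal_le {L : ℕ} (hL : 1 < L) {b₀ p₀ : ℝ} (hb : 0 < b₀) (hp : 0 < p₀) {m : ℕ} (hm : 0 < m)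
    {σ : ℝ} (hσ : 0 < σ) :
    ∃ γ₁ : ℝ, 0 < γ₁ ∧ γ₁ ≤ 1 ∧ ∀ γ : ℝ, 0 < γ → γ ≤ γ₁ → ∀ K : ℕ, ((K : ℝ) + 2) * θBal L γ b₀ p₀ (K / m) ≤ σ := by
  have hL1 : (1 : ℝ) < L := by exact_mod_cast hL
  have hL0 : (0 : ℝ) < L := zero_lt_one.trans hL1
  set x : ℝ := (L : ℝ)⁻¹ with hx_def
  have hx : 0 < x := inv_pos.mpr hL0
  have hx1 : x < 1 := inv_lt_one_of_one_lt₀ hL1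
  -- `q := x^{1/4}`
  set q : ℝ := Real.sqrt (Real.sqrt x) with hq_def
  have hq : 0 < q := Real.sqrt_pos.mpr (Real.sqrt_pos.mpr hx)
  have hq1 : q < 1 := by
    have h1 : Real.sqrt x < 1 := (Real.sqrt_lt_sqrt hx.le hx1).trans_eq Real.sqrt_one
    exact (Real.sqrt_lt_sqrt (Real.sqrt_nonneg _) h1).trans_eq Real.sqrt_one
  -- the constants
  set C₀ : ℝ := b₀ * ((2 * p₀) ^ p₀ * Real.exp (1 / 2 - p₀)) with hC₀_def
  have hC₀ : 0 < C₀ := by positivity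
  set S₀ : ℝ := q / (1 - q) ^ 2 + 1 with hS₀_def
  have hS₀ : 0 < S₀ := by
    have h0 : 0 ≤ q / (1 - q) ^ 2 := by positivity
    rw [hS₀_def]; linarith
  set D : ℝ := (m : ℝ) * S₀ + 2 with hD_def
  have hD : 0 < D := by
    rw [hD_def]; exact add_pos_of_nonneg_of_pos (mul_nonneg (Nat.cast_nonneg _) hS₀.le) two_pos
  set t : ℝ := σ / (C₀ * D) with ht_def
  have ht : 0 < t := by rw [ht_def]; exact div_pos hσ (mul_pos hC₀ hD)
  refine ⟨min 1 (t ^ 4), lt_min one_pos (pow_pos ht 4), min_le_left _ _, fun γ hγ hγle K => ?_⟩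
  have hγ1 : γ ≤ 1 := hγle.trans (min_le_left _ _)
  have hγt : γ ≤ t ^ 4 := hγle.trans (min_le_right _ _)
  set n : ℕ := K / m with hn_def
  -- `θ(n) ≤ C₀·√(√(γ x^n)) = C₀·√(√γ)·qⁿ`
  have hθ := θBal_le_const_mul_sqrt_coupling (L := L) (γ := γ) (b₀ := b₀) (p₀ := p₀) hL.le hγ hγ1 hb.le hp n
  have hsplit : Real.sqrt (Real.sqrt (γ * ((L : ℝ)⁻¹) ^ n)) = Real.sqrt (Real.sqrt γ) * q ^ n := by
    rw [Real.sqrt_mul hγ.le, sqrt_pow_eq hx.le, Real.sqrt_mul (Real.sqrt_nonneg γ), sqrt_pow_eq (Real.sqrt_nonneg x)]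
  rw [hsplit] at hθ
  -- `√(√γ) ≤ t`
  have hγ4 : Real.sqrt (Real.sqrt γ) ≤ t := by
    have h1 : Real.sqrt γ ≤ t ^ 2 := by
      rw [show t ^ 4 = (t ^ 2) ^ 2 by ring] at hγt
      exact (Real.sqrt_le_sqrt hγt).trans_eq (Real.sqrt_sq (by positivity))
    exact (Real.sqrt_le_sqrt h1).trans_eq (Real.sqrt_sq ht.le)
  -- `(K + 2)·qⁿ ≤ D`
  have hKn : (K : ℝ) + 2 ≤ (m : ℝ) * ((n : ℝ) + 1) + 2 := by
    have h : K < m * (n + 1) := by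
      rw [hn_def]; exact Nat.lt_mul_div_succ K hm
    have h' : (K : ℝ) ≤ (m : ℝ) * ((n : ℝ) + 1) := by exact_mod_cast h.le
    linarith
  have hqn1 : q ^ n ≤ 1 := pow_le_one₀ hq.le hq1.le
  have hnq : ((n : ℝ) + 1) * q ^ n ≤ S₀ := by
    rw [add_mul, one_mul]
    exact add_le_add (nat_mul_pow_le hq.le hq1 n) hqn1
  have hKq : ((K : ℝ) + 2) * q ^ n ≤ D := by
    calc ((K : ℝ) + 2) * q ^ n ≤ ((m : ℝ) * ((n : ℝ) + 1) + 2) * q ^ n := mul_le_mul_of_nonneg_right hKn (pow_nonneg hq.le _)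
      _ = (m : ℝ) * (((n : ℝ) + 1) * q ^ n) + 2 * q ^ n := by ring
      _ ≤ (m : ℝ) * S₀ + 2 * 1 := add_le_add (mul_le_mul_of_nonneg_left hnq (Nat.cast_nonneg _)) (by linarith)
      _ = D := by rw [hD_def]; ring
  -- assemble
  have hθ0 : 0 ≤ θBal L γ b₀ p₀ n := (θBal_pos hL.le hγ hγ1 hb p₀ n).le
  calc ((K : ℝ) + 2) * θBal L γ b₀ p₀ n
      ≤ ((K : ℝ) + 2) * (C₀ * (Real.sqrt (Real.sqrt γ) * q ^ n)) := mul_le_mul_of_nonneg_left hθ (by positivity)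
    _ = C₀ * Real.sqrt (Real.sqrt γ) * (((K : ℝ) + 2) * q ^ n) := by ring
    _ ≤ C₀ * t * D := by
        refine mul_le_mul (mul_le_mul_of_nonneg_left hγ4 hC₀.le) hKq (by positivity) (by positivity)
    _ = σ := by rw [ht_def]; field_simp

/-- The same `γ₁` also gives `θBal L γ b₀ p₀ ⌊K/m⌋ ≤ σ` (`K + 2 ≥ 1`). [cite: Balaban1985UV3, (7) p.257] -/
theorem θBal_le_of_Kmul_le {L : ℕ} (hL : 1 ≤ L) {γ b₀ p₀ : ℝ} (hγ : 0 < γ) (hγ1 : γ ≤ 1) (hb : 0 < b₀) {m K : ℕ} {σ : ℝ}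
    (h : ((K : ℝ) + 2) * θBal L γ b₀ p₀ (K / m) ≤ σ) : θBal L γ b₀ p₀ (K / m) ≤ σ := by
  have hθ0 : 0 ≤ θBal L γ b₀ p₀ (K / m) := (θBal_pos hL hγ hγ1 hb p₀ (K / m)).le
  have hK : (1 : ℝ) ≤ (K : ℝ) + 2 := by have := Nat.cast_nonneg (α := ℝ) K; linarith
  exact (le_mul_of_one_le_left hθ0 hK).trans h

end Thresholds

/-! ## §3 LOWER's divergence clause from the weakened schema -/

section LowerDiv

variable (F : T3Family)

/-- `d − 1 = 2` for the family (bookkeeping). [cite: Balaban1985UV3, (1)-(3) p.256] -/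
private theorem d_sub_one_cast (K : ℕ) : (((F.P K).d - 1 : ℕ) : ℝ) = 2 := by
  rw [T3Family.P_d]; norm_num

/-- `(K + 1 − n) + 1 = (K − n) + 2` as reals, `n ≤ K` (bookkeeping). [folklore] -/
private theorem cast_succ_sub_add_one {n K : ℕ} (hnK : n ≤ K) : (((K + 1 - n : ℕ) : ℝ) + 1) = ((K - n : ℕ) : ℝ) + 2 := by
  rw [show K + 1 - n = (K - n) + 1 by omega]; push_cast; ring

variable {F}

/-- **THE DIVERGENCE CLAUSE OF THE AVERAGED MINIMISER FROM THE WEAKENED SCHEMA** (G-K1a-3a under a K-dependent window, PROVED): given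
`MinimiserCurvGradLogAt L a₀ a₁ B₃ B₄`, `AvgCurvGradAt L C₁ C₂ c` and `4C₁B₄ ≤ L³B₃`, a minimiser `U′` over (6)_{K+1}(ε₀) lying in (8)_{K+1}(B₃ε₁)
(`0 < ε₁ ≤ min {a₁, c/B₃, L³/(8C₂B₃)}`, `B₃ε₁ ≤ ε₀ ≤ a₀`) whose data satisfy the window `B₃((K − n) + 2)ε₁ ≤ ε₀` has a one-step average obeying the
divergence clause (1.9) of run `K` at radius `ε₀`: `2(C₁b + C₂a²) ≤ (½B₃((K−n)+2)ε₁ + ¼B₃ε₁)L^{−3(K−n)} ≤ ¾ε₀L^{−3(K−n)}` with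
`b = B₄ε₁((K+1−n)+1)L^{−3(K+1−n)}`, `a = B₃ε₁L^{−2(K+1−n)}`. [cite: Balaban1985Variational, Thm 1 (8)-(10) p.279; Balaban1985RegularSpaces, (1.9) p.77] -/
theorem divSmall_descendTo_log {L : ℕ} {a₀ a₁ B₃ B₄ C₁ C₂ c : ℝ} (hB₃ : 0 < B₃) (hB₄ : 0 ≤ B₄) (hC₂ : 0 < C₂)
    (hgrad : MinimiserCurvGradLogAt L a₀ a₁ B₃ B₄) (havg : AvgCurvGradAt L C₁ C₂ c) (hdom : 4 * (C₁ * B₄) ≤ (L : ℝ) ^ 3 * B₃)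
    (hF : F.L = L) {n K : ℕ} (hnK : n < K) {ε₁ ε₀ : ℝ} (hε₁ : 0 < ε₁) (hε₁a : ε₁ ≤ a₁) (hε₁c : ε₁ ≤ c / B₃)
    (hε₁L : ε₁ ≤ (L : ℝ) ^ 3 / (8 * C₂ * B₃)) (hlo : B₃ * ε₁ ≤ ε₀) (hhi : ε₀ ≤ a₀)
    (hwin : B₃ * (((K - n : ℕ) : ℝ) + 2) * ε₁ ≤ ε₀)
    {V : GaugeField (F.P n) 0 (Matrix.specialUnitaryGroup (Fin 2) ℂ)} (hV : PlaqSmall ε₁ V)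
    {U' : GaugeField (F.P (K + 1)) 0 (Matrix.specialUnitaryGroup (Fin 2) ℂ)}
    (hU'8 : U' ∈ regFibrePr F n (K + 1) (hnK.le.trans (Nat.le_succ K)) (B₃ * ε₁) V)
    (hmin : IsMinOn (fun W : GaugeField (F.P (K + 1)) 0 (Matrix.specialUnitaryGroup (Fin 2) ℂ) => wilsonAction4 W)
      (regFibrePr F n (K + 1) (hnK.le.trans (Nat.le_succ K)) ε₀ V) U') :
    DivSmall F n K ε₀ (descendTo F ℰp K (K + 1) (Nat.le_succ K) U') := by
  have hL : (0 : ℝ) < F.L := L_cast_pos F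
  have hL' : (0 : ℝ) < (L : ℝ) := by rw [← hF]; exact hL
  have hnK' : n < K + 1 := hnK.trans (Nat.lt_succ_self K)
  have hBε : 0 < B₃ * ε₁ := mul_pos hB₃ hε₁
  have hε₀ : 0 < ε₀ := hBε.trans_le hlo
  -- the minimiser lies in (6)_{K+1}(ε₀) and its curvature derivatives are `< b`
  have hU'6 : U' ∈ regFibrePr F n (K + 1) hnK'.le ε₀ V := regFibrePr_mono F hlo V hU'8
  set b : ℝ := B₄ * ε₁ * (((K + 1 - n : ℕ) : ℝ) + 1) * ((F.L : ℝ)⁻¹) ^ (3 * (K + 1 - n)) with hb_def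
  have hk0 : (0 : ℝ) ≤ ((K + 1 - n : ℕ) : ℝ) + 1 := by positivity
  have hb0 : 0 ≤ b := by positivity
  have hder : ∀ (x : Site (F.P (K + 1)) 0) (ν κ κ' : Fin (F.P (K + 1)).d), κ ≠ κ' →
      ‖covDerivT 1 (unitsField (toUField U')) ν (plaqFT (unitsField (toUField U')) κ κ') x‖ ≤ b :=
    fun x ν κ κ' hne => (hgrad F hF n (K + 1) hnK' ε₁ ε₀ hε₁ hε₁a hlo hhi V hV U' hU'6 hmin x ν κ κ' hne).le
  -- its plaquettes are `< a = B₃ε₁L^{−2(K+1−n)} ≤ B₃ε₁ ≤ c`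
  set a : ℝ := regThreshold F n (K + 1) (B₃ * ε₁) with ha_def
  obtain ⟨hs, hs1⟩ := scale_pos_le_one F (2 * (K + 1 - n))
  have ha0 : 0 ≤ a := (mul_pos hBε hs).le
  have hac : a ≤ c := by
    have h1 : a ≤ B₃ * ε₁ := mul_le_of_le_one_right hBε.le hs1
    have h2 : B₃ * ε₁ ≤ c := by
      have := mul_le_mul_of_nonneg_left hε₁c hB₃.le
      rwa [mul_div_cancel₀ _ hB₃.ne'] at this
    exact h1.trans h2
  have hplaq : PlaqSmall a U' := hU'8.1.2
  -- the averaging schema: curvature derivatives of the average `≤ C₁b + C₂a²`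
  have hout := havg F hF K a b ha0 hac hb0 U' hplaq hder
  -- the divergence at every bond of run `K`
  intro bd
  have hdiv := norm_covDivT_le_of_covDerivT_le (unitsField (toUField (descendTo F ℰp K (K + 1) (Nat.le_succ K) U')))
    (x := bd.src) (fun ν κ κ' hne => hout bd.src ν κ κ' hne) bd.dir
  rw [d_sub_one_cast] at hdiv
  refine hdiv.trans_lt ?_
  -- arithmetic: `2(C₁b + C₂a²) < ε₀·L^{−3(K−n)}`
  obtain ⟨hb_eq, ha_le⟩ := scale_succ_bounds F hnK.le
  set t : ℝ := ((F.L : ℝ)⁻¹) ^ (3 * (K - n)) with ht_def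
  obtain ⟨ht, _⟩ := scale_pos_le_one F (3 * (K - n))
  have hL3 : ((F.L : ℝ)⁻¹) ^ 3 = ((L : ℝ) ^ 3)⁻¹ := by rw [hF, inv_pow]
  set kk : ℝ := ((K - n : ℕ) : ℝ) + 2 with hkk_def
  have hkk1 : (1 : ℝ) ≤ kk := by have := Nat.cast_nonneg (α := ℝ) (K - n); rw [hkk_def]; linarith
  -- `b = B₄ε₁·kk·L^{−3}t`, `a² ≤ B₃²ε₁²L^{−3}t`
  have hb : b = B₄ * ε₁ * kk * ((L : ℝ) ^ 3)⁻¹ * t := by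
    rw [hb_def, cast_succ_sub_add_one hnK.le, hb_eq, hL3, ← hkk_def]; ring
  have ha2 : a ^ 2 ≤ (B₃ * ε₁) ^ 2 * ((L : ℝ) ^ 3)⁻¹ * t := by
    rw [ha_def]
    unfold regThreshold
    rw [mul_pow, mul_assoc]
    exact mul_le_mul_of_nonneg_left (by rw [← hL3]; exact ha_le) (sq_nonneg _)
  -- `C₁B₄ε₁kk/L³ ≤ B₃ε₁kk/4` and `C₂B₃²ε₁²/L³ ≤ B₃ε₁/8`
  have hL3pos : (0 : ℝ) < (L : ℝ) ^ 3 := by positivity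
  have h1 : C₁ * (B₄ * ε₁ * kk * ((L : ℝ) ^ 3)⁻¹) ≤ B₃ * kk * ε₁ / 4 := by
    rw [show C₁ * (B₄ * ε₁ * kk * ((L : ℝ) ^ 3)⁻¹) = (C₁ * B₄) * (ε₁ * kk) / (L : ℝ) ^ 3 by ring,
      div_le_iff₀ hL3pos]
    have hεk : 0 ≤ ε₁ * kk := by positivity
    nlinarith [mul_le_mul_of_nonneg_right hdom hεk]
  have h2 : C₂ * ((B₃ * ε₁) ^ 2 * ((L : ℝ) ^ 3)⁻¹) ≤ B₃ * ε₁ / 8 := by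
    have h8 : 0 < 8 * C₂ * B₃ := by positivity
    have hε : 8 * C₂ * B₃ * ε₁ ≤ (L : ℝ) ^ 3 := by
      have := mul_le_mul_of_nonneg_left hε₁L h8.le
      rwa [mul_div_cancel₀ _ h8.ne'] at this
    rw [show C₂ * ((B₃ * ε₁) ^ 2 * ((L : ℝ) ^ 3)⁻¹) = (C₂ * B₃ * ε₁) * (B₃ * ε₁) / (L : ℝ) ^ 3 by ring,
      div_le_iff₀ hL3pos]
    nlinarith [hBε]
  have hwin' : B₃ * kk * ε₁ ≤ ε₀ := hwin
  calc 2 * (C₁ * b + C₂ * a ^ 2)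
      ≤ 2 * (C₁ * (B₄ * ε₁ * kk * ((L : ℝ) ^ 3)⁻¹ * t) + C₂ * ((B₃ * ε₁) ^ 2 * ((L : ℝ) ^ 3)⁻¹ * t)) := by
        rw [hb]; gcongr
    _ = 2 * (C₁ * (B₄ * ε₁ * kk * ((L : ℝ) ^ 3)⁻¹) + C₂ * ((B₃ * ε₁) ^ 2 * ((L : ℝ) ^ 3)⁻¹)) * t := by ring
    _ ≤ 2 * (B₃ * kk * ε₁ / 4 + B₃ * ε₁ / 8) * t := by gcongr
    _ < ε₀ * t := by
        refine mul_lt_mul_of_pos_right ?_ ht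
        linarith [hwin', hlo, hε₀]

/-- **THE COMPETITOR IS ADMISSIBLE** under the K-dependent window: the one-step average of a minimiser in (8)_{K+1} lies in print's regular fibre (6)
of run `K` (plaquette clause PROVED — `T3OneStepAveragingPlaquettes.plaqSmall_descendTo_of_mem8'`; divergence clause `divSmall_descendTo_log`).
[cite: Balaban1985Variational, (6) p.278] -/
theorem descendTo_mem_regFibrePr_log {L : ℕ} {a₀ a₁ B₃ B₄ C₁ C₂ c : ℝ} (hB₃ : 0 < B₃) (hB₄ : 0 ≤ B₄) (hC₂ : 0 < C₂)
    (hgrad : MinimiserCurvGradLogAt L a₀ a₁ B₃ B₄) (havg : AvgCurvGradAt L C₁ C₂ c) (hdom : 4 * (C₁ * B₄) ≤ (L : ℝ) ^ 3 * B₃)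
    (hF : F.L = L) {n K : ℕ} (hnK : n < K) {ε₁ ε₀ : ℝ} (hε₁ : 0 < ε₁) (hε₁a : ε₁ ≤ a₁) (hε₁c : ε₁ ≤ c / B₃)
    (hε₁L : ε₁ ≤ (L : ℝ) ^ 3 / (8 * C₂ * B₃)) (hlo : B₃ * ε₁ ≤ ε₀) (hhi : ε₀ ≤ a₀)
    (hwin : B₃ * (((K - n : ℕ) : ℝ) + 2) * ε₁ ≤ ε₀) (h151 : 151 * (B₃ * ε₁) ≤ ε₀)
    (hδ : (25 * (F.L : ℝ) ^ 2 / 4) * (B₃ * ε₁) < deltaSU (Fin 2))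
    {V : GaugeField (F.P n) 0 (Matrix.specialUnitaryGroup (Fin 2) ℂ)} (hV : PlaqSmall ε₁ V)
    {U' : GaugeField (F.P (K + 1)) 0 (Matrix.specialUnitaryGroup (Fin 2) ℂ)}
    (hU'8 : U' ∈ regFibrePr F n (K + 1) (hnK.le.trans (Nat.le_succ K)) (B₃ * ε₁) V)
    (hmin : IsMinOn (fun W : GaugeField (F.P (K + 1)) 0 (Matrix.specialUnitaryGroup (Fin 2) ℂ) => wilsonAction4 W)
      (regFibrePr F n (K + 1) (hnK.le.trans (Nat.le_succ K)) ε₀ V) U') :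
    descendTo F ℰp K (K + 1) (Nat.le_succ K) U' ∈ regFibrePr F n K hnK.le ε₀ V :=
  ⟨⟨descendTo_mem_fibre F ℰp hnK.le (Nat.le_succ K) hU'8.1.1,
      plaqSmall_descendTo_of_mem8' F hnK.le (mul_pos hB₃ hε₁) h151 hδ hU'8⟩,
    divSmall_descendTo_log hB₃ hB₄ hC₂ hgrad havg hdom hF hnK hε₁ hε₁a hε₁c hε₁L hlo hhi hwin hV hU'8 hmin⟩

end LowerDiv

end Literature.MathematicalPhysics.QuantumFieldTheory.Balaban1983to89.T3CurvGradLog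

end
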